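import Summits.CriticalPhenomena.PercolationContinuityZ3.Theses.PercNearOneGluing
import Literature.Probability.Percolation.TwoClusterConditionalAssociationProofs
import HarnessLib

/-!
# Crux `PercNearOneGluing.AdditiveGluing` (stmt-CriticalPhenomena-4576), line `tieline`: off-cluster association
# (van den Berg–Häggström–Kahn's Thm. 1.5 with `C_t` replaced by the configuration off `C̄_s` and `{s ↮ t}` by `{s ↮ X}`)

Support file (`--supports stmt-CriticalPhenomena-4576`, helper, lead c11).  No definitions, no named facts, no sorries
(two file-local `notation3`s abbreviate tree terms in the SOURCE only; every statement elaborates to the spelled-out term).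

Setting: `μ = prodBernoulli w` (arbitrary edge weights, finite vertex type `V`), a vertex `s`, an avoided set `X ∌ s`,
`D = D⟦s, X⟧ = {s ↮ X} = {ω | ∀ x ∈ X, ¬ s ↔ x}`, `C_s = openEdgeCluster ω s`, `W̄ = B⟦W, s⟧ =
{e | ∃ v ∈ e, v = s ∨ ∃ e' ∈ W, v ∈ e'}` (the pairs meeting `{s} ∪ V(W)`, spelled out as in
`Literature/…/TwoClusterConditionalAssociationProofs.lean`), and the **off-cluster configuration**
`ω ∖ C̄_s(ω) = ω \ B⟦openEdgeCluster ω s, s⟧` (the open pairs not touching the vertex cluster of `s`).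

* `OffCluster.offClusterAssoc` — given `D`, functions `F(C_s, ω ∖ C̄_s)`, `G(C_s, ω ∖ C̄_s)` increasing in `C_s` and
  decreasing in the off-cluster configuration are positively associated, `(∫_D f)(∫_D g) ≤ μ(D) ∫_D f g`  (BHK's
  Thm. 1.5 is the case `X = {t}`, `F(C, E) = F'(C, C_t(E))`: on `{s ↮ t}`, `C_t(ω) = C_t(ω ∖ C̄_s)`).  The proof is BHK's
  proof of Thm. 1.5 (pp. 7–8) verbatim: condition on `C_s = W` (display (10): the configuration off `W̄` is a fresh
  percolation — block Fubini `BHK2006.blockFubini` on the cylinder `{C_s = W}`, here `sum_cond_cluster_off_ind`), Harris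
  in the fresh variables (`BHK2006.harris_anti_anti`), monotonicity in `W` of the conditional averages (`W̄` grows with
  `W`), and Thm. 1.3 given `{s ↮ X}` (`BHK2006_clusterConditionalPositiveAssociation_holds`);
* sign variants `offClusterAssoc_anti_mono`, `offClusterAssoc_mixed`; the one-variable rows (GP1) `offCluster_posAssoc`,
  (GP3) `offCluster_cluster_negCorr`; the event forms `offCluster_event_posAssoc`, `offCluster_event_negCorr`; and, via
  `{x ↔ y} ∩ {x ↮ s} = {x ↔ y in ω ∖ C̄_s} ∩ {x ∉ {s} ∪ V(C_s)}` (`openConn_inter_compl_eq`), the `s`-free connection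
  rows (E1) `μ(D ∩ E₁) μ(D ∩ E₂) ≤ μ(D) μ(D ∩ E₁ ∩ E₂)` and (E3) `μ(D) μ(D ∩ E₁ ∩ {s ↔ z}) ≤ μ(D ∩ E₁) μ(D ∩ {s ↔ z})`
  for `Eᵢ = {xᵢ ↔ yᵢ} ∩ {xᵢ ↮ s}` (`sFreeConn_posAssoc`, `sFreeConn_openConn_negCorr`; no hypothesis on the vertices).
[cite: VandenbergHaggstromKahn2005, Thm. 1.3 (p. 6), Thm. 1.5 (p. 7), proof pp. 7–8 — corollary]
-/

namespace Summit.CriticalPhenomena.PercolationContinuityZ3.Cruxes.AdditiveGluing.TieLine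

open MeasureTheory Set
open Literature.Probability.LatticeModels (prodBernoulli)
open Literature.Probability.Percolation
open Literature.Probability.Percolation.BHK2006
open Literature.Probability.Percolation.DecisionTree (ind ind_of_mem ind_of_not_mem ind_nonneg)

noncomputable section
open scoped Classical

/-- `D⟦s, X⟧ = {s ↮ X}`: file-local source abbreviation of the tree term `{ω | ∀ x ∈ X, ¬ (openGraph ω).Reachable s x}`
(the conditioning event of `BHK2006_clusterConditionalPositiveAssociation`). -/
local notation3 (prettyPrint := false) "D⟦" s ", " X "⟧" => {ω | ∀ x ∈ X, ¬ (openGraph ω).Reachable s x}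

/-- `B⟦W, s⟧ = W̄`: file-local source abbreviation of the tree term `{e | ∃ v ∈ e, v = s ∨ ∃ e' ∈ W, v ∈ e'}` (the pairs
meeting `{s} ∪ V(W)`); the off-cluster configuration is `ω \ B⟦openEdgeCluster ω s, s⟧`. -/
local notation3 (prettyPrint := false) "B⟦" W ", " s "⟧" => {e | ∃ v ∈ e, v = s ∨ ∃ e' ∈ W, v ∈ e'}

namespace OffCluster

variable {V : Type*}

section Graph

/-- **Off-cluster reachability.**  If `x ↮ s`, then `x ↔ y` in `ω` iff `x ↔ y` in the off-cluster configuration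
`ω ∖ C̄_s(ω)` (an open path from `x` never touches the vertex cluster of `s`). [cite: VandenbergHaggstromKahn2005, §1 p. 8] -/
theorem reachable_off_iff {ω : Set (Sym2 V)} {s x : V} (hx : ¬ (openGraph ω).Reachable x s) (y : V) :
    (openGraph ω).Reachable x y ↔ (openGraph (ω \ B⟦openEdgeCluster ω s, s⟧)).Reachable x y := by
  rw [reachable_iff_exists_mem_openEdgeCluster ω x y, reachable_iff_exists_mem_openEdgeCluster _ x y,
    openEdgeCluster_eq_sdiff_bar rfl fun h => hx ((reachable_iff_exists_mem_openEdgeCluster ω s x).2 h).symm]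

/-- **The `s`-free connection event read off `(C_s, ω ∖ C̄_s)`**: `{x ↔ y} ∩ {x ↮ s} = {x ↔ y in ω ∖ C̄_s(ω)} ∩
{x ∉ {s} ∪ V(C_s)}` — increasing off `C̄_s`, decreasing in `C_s` (any `x, y`). [cite: VandenbergHaggstromKahn2005, §1 p. 8] -/
theorem openConn_inter_compl_eq (s x y : V) :
    (openConn x y ∩ (openConn x s)ᶜ : Set (BondConfig V)) = {ω | (openGraph (ω \ B⟦openEdgeCluster ω s, s⟧)).Reachable x y ∧
        ¬ (x = s ∨ ∃ e ∈ openEdgeCluster ω s, x ∈ e)} := by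
  ext ω
  simp only [mem_inter_iff, mem_compl_iff, openConn, mem_setOf_eq]
  constructor
  · rintro ⟨hxy, hxs⟩
    exact ⟨(reachable_off_iff hxs y).1 hxy, fun h => hxs ((reachable_iff_exists_mem_openEdgeCluster ω s x).2 h).symm⟩
  · rintro ⟨hxy, hxs⟩
    have hxs' : ¬ (openGraph ω).Reachable x s := fun h =>
      hxs ((reachable_iff_exists_mem_openEdgeCluster ω s x).1 h.symm)
    exact ⟨(reachable_off_iff hxs' y).2 hxy, hxs'⟩

/-- `{s ↔ z} = {z ∈ {s} ∪ V(C_s)}`, an increasing event of `C_s`.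
[cite: VandenbergHaggstromKahn2005, §1 p. 3 ("A simple example of such an event is {s ↔ a}")] -/
theorem openConn_eq_setOf (s z : V) :
    (openConn s z : Set (BondConfig V)) = {ω | z = s ∨ ∃ e ∈ openEdgeCluster ω s, z ∈ e} :=
  Set.ext fun ω => reachable_iff_exists_mem_openEdgeCluster ω s z

/-- `1_D` for `D = {s ↮ X}` as a (decreasing) function of `C_s`: `1{∀ x ∈ X, x ∉ {s} ∪ V(C_s)}`.
[cite: VandenbergHaggstromKahn2005, §1 p. 3 (the events `R_X = {s ↮ X}`)] -/
theorem ite_avoid_eq_ind (s : V) (X : Set V) {D : Set (Set (Sym2 V))}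
    (hD : ∀ ω, ω ∈ D ↔ ∀ x ∈ X, ¬ (openGraph ω).Reachable s x) (ω : Set (Sym2 V)) :
    (if ∀ x ∈ X, ¬ (x = s ∨ ∃ e ∈ openEdgeCluster ω s, x ∈ e) then (1 : ℝ) else 0) = ind D ω := by
  have key : (∀ x ∈ X, ¬ (x = s ∨ ∃ e ∈ openEdgeCluster ω s, x ∈ e)) ↔ ω ∈ D := by
    rw [hD]
    refine forall₂_congr fun x _ => ?_
    rw [reachable_iff_exists_mem_openEdgeCluster]
  by_cases h : ∀ x ∈ X, ¬ (x = s ∨ ∃ e ∈ openEdgeCluster ω s, x ∈ e)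
  · rw [if_pos h, ind_of_mem (key.1 h)]
  · rw [if_neg h, ind_of_not_mem (fun h' => h (key.2 h'))]

/-- The `0/1` function of an increasing predicate is increasing. [folklore] -/
theorem monotone_ite {α : Type*} [Preorder α] {p : α → Prop} (hp : ∀ ⦃a b⦄, a ≤ b → p a → p b) :
    Monotone fun a => if p a then (1 : ℝ) else 0 := by
  intro a b hab
  show (if p a then (1 : ℝ) else 0) ≤ if p b then 1 else 0
  by_cases ha : p a
  · rw [if_pos ha, if_pos (hp hab ha)]
  · rw [if_neg ha]; split_ifs <;> norm_num

/-- The `0/1` function of a decreasing predicate is decreasing. [folklore] -/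
theorem antitone_ite {α : Type*} [Preorder α] {p : α → Prop} (hp : ∀ ⦃a b⦄, a ≤ b → p b → p a) :
    Antitone fun a => if p a then (1 : ℝ) else 0 := by
  intro a b hab
  show (if p b then (1 : ℝ) else 0) ≤ if p a then 1 else 0
  by_cases hb : p b
  · rw [if_pos hb, if_pos (hp hab hb)]
  · rw [if_neg hb]; split_ifs <;> norm_num

/-- `1{p} · 1{q} = 1{p ∧ q}`. [folklore] -/
theorem ite_one_mul_ite_one (p q : Prop) :
    (if p then (1 : ℝ) else 0) * (if q then 1 else 0) = if p ∧ q then 1 else 0 := by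
  by_cases hp : p <;> by_cases hq : q <;> simp [hp, hq]

end Graph

section Sums

variable [Fintype V]

/-- "`E[f | C_s = W]` and `E[g | C_s = W]` are increasing functions of `W`": for `H` increasing in its first and decreasing
in its second argument, `W ↦ Σ_η weight(η) H(W, η ∖ W̄)` is increasing. [cite: VandenbergHaggstromKahn2005, Thm. 1.5, proof p. 8] -/
theorem condAvg_off_mono {w : Sym2 V → ℝ} (hw0 : ∀ e, 0 ≤ w e) (hw1 : ∀ e, w e ≤ 1) (s : V)
    {H : Set (Sym2 V) → Set (Sym2 V) → ℝ} (hH1 : ∀ E, Monotone fun C => H C E) (hH2 : ∀ C, Antitone fun E => H C E) :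
    Monotone fun W => ∑ η, weight w η * H W (η \ B⟦W, s⟧) := by
  intro W W' hWW'
  refine Finset.sum_le_sum fun η _ => mul_le_mul_of_nonneg_left ?_ (weight_nonneg hw0 hw1 η)
  exact (hH1 _ hWW').trans (hH2 W' (Set.sdiff_subset_sdiff_right (bar_mono s hWW')))

/-- "by Harris' inequality, `E[f g | C_s = W] ≥ E[f | C_s = W] E[g | C_s = W]`": given `C_s = W`, `f, g` are decreasing
functions of the fresh configuration `η ∖ B`, `B = W̄`. [cite: VandenbergHaggstromKahn2005, Thm. 1.5, proof p. 8] -/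
theorem condAvg_off_mul_le {w : Sym2 V → ℝ} (hw0 : ∀ e, 0 ≤ w e) (hw1 : ∀ e, w e ≤ 1) (hm : ∑ ω, weight w ω = 1)
    (B : Set (Sym2 V)) {F G : Set (Sym2 V) → Set (Sym2 V) → ℝ}
    (hF2 : ∀ C, Antitone fun E => F C E) (hG2 : ∀ C, Antitone fun E => G C E) (W : Set (Sym2 V)) :
    (∑ η, weight w η * F W (η \ B)) * ∑ η, weight w η * G W (η \ B) ≤
      ∑ η, weight w η * (F W (η \ B) * G W (η \ B)) :=
  harris_anti_anti hw0 hw1 hm (f := fun η => F W (η \ B)) (g := fun η => G W (η \ B))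
    (fun _ _ hab => hF2 W (Set.sdiff_subset_sdiff_left hab)) (fun _ _ hab => hG2 W (Set.sdiff_subset_sdiff_left hab))
    (M := F W ∅) (N := G W ∅) (fun η => hF2 W (Set.empty_subset (η \ B))) (fun η => hG2 W (Set.empty_subset (η \ B)))

/-- **BHK's display (10) for functions of `(C_s, ω ∖ C̄_s)` on `D = {s ↮ X}`**: `E[H(C_s, ω ∖ C̄_s) 1_D] =
Σ_ω weight(ω) (Σ_η weight(η) H(C_s ω, η ∖ C̄_s(ω))) 1_D(ω)` — given `C_s = W` the configuration off `W̄` is a fresh percolation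
(block Fubini on the cylinder `{C_s = W}`), and `1_D` is a function of `C_s`. [cite: VandenbergHaggstromKahn2005, §1 pp. 7–8, (10)] -/
theorem sum_cond_cluster_off_ind (w : Sym2 V → ℝ) (hm : ∑ ω, weight w ω = 1) (s : V) (X : Set V)
    (H : Set (Sym2 V) → Set (Sym2 V) → ℝ) {D : Set (Set (Sym2 V))}
    (hD : ∀ ω, ω ∈ D ↔ ∀ x ∈ X, ¬ (openGraph ω).Reachable s x) :
    ∑ ω, weight w ω * (H (openEdgeCluster ω s) (ω \ B⟦openEdgeCluster ω s, s⟧) * ind D ω) =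
      ∑ ω, weight w ω * ((∑ η, weight w η * H (openEdgeCluster ω s) (η \ B⟦openEdgeCluster ω s, s⟧)) * ind D ω) := by
  -- the identity on each event `{C_s = W}`: block Fubini with the block `W̄`
  have key : ∀ W : Set (Sym2 V),
      ∑ ω, (if openEdgeCluster ω s = W then weight w ω * (H W (ω \ B⟦W, s⟧) * ind D ω) else 0) =
      ∑ ω, (if openEdgeCluster ω s = W then weight w ω * ((∑ η, weight w η * H W (η \ B⟦W, s⟧)) * ind D ω) else 0) := by
    intro W
    set A : Set (Sym2 V) := B⟦W, s⟧ with hA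
    -- `1_D` is constant on `{C_s = W}`
    have hind : ∀ ω ω', openEdgeCluster ω s = W → openEdgeCluster ω' s = W → ind D ω = ind D ω' :=
      fun ω ω' hω hω' => by rw [← ite_avoid_eq_ind s X hD ω, ← ite_avoid_eq_ind s X hD ω', hω, hω']
    set Φ : Set (Sym2 V) → Set (Sym2 V) → ℝ := fun ζ η =>
      if openEdgeCluster ζ s = W then H W (η \ A) * ind D ζ else 0 with hΦ
    have h1 : ∀ ω, (if openEdgeCluster ω s = W then weight w ω * (H W (ω \ A) * ind D ω) else 0) =
        weight w ω * Φ (ω ∩ A) (ω \ A) := by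
      intro ω
      simp only [hΦ, hA, openEdgeCluster_inter_bar_eq_iff]
      rw [← hA, sdiff_idem]
      split_ifs with hW
      exacts [by rw [hind (ω ∩ A) ω ((openEdgeCluster_inter_bar_eq_iff s W ω).2 hW) hW], by rw [mul_zero]]
    have h2 : ∀ ω, weight w ω * ∑ ω', weight w ω' * Φ (ω ∩ A) (ω' \ A) =
        (if openEdgeCluster ω s = W then weight w ω * ((∑ η, weight w η * H W (η \ A)) * ind D ω) else 0) := by
      intro ω
      simp only [hΦ, hA, openEdgeCluster_inter_bar_eq_iff]
      rw [← hA]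
      split_ifs with hW
      · rw [hind (ω ∩ A) ω ((openEdgeCluster_inter_bar_eq_iff s W ω).2 hW) hW, Finset.sum_mul]
        exact congrArg _ (Finset.sum_congr rfl fun η _ => by rw [sdiff_idem]; ring)
      · simp
    calc ∑ ω, (if openEdgeCluster ω s = W then weight w ω * (H W (ω \ A) * ind D ω) else 0)
        = (∑ ω, weight w ω) * ∑ ω, weight w ω * Φ (ω ∩ A) (ω \ A) := by
          rw [hm, one_mul]; exact Finset.sum_congr rfl fun ω _ => h1 ω
      _ = ∑ ω, weight w ω * ∑ ω', weight w ω' * Φ (ω ∩ A) (ω' \ A) := blockFubini w A Φ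
      _ = _ := Finset.sum_congr rfl fun ω _ => h2 ω
  -- sum over `W`
  calc ∑ ω, weight w ω * (H (openEdgeCluster ω s) (ω \ B⟦openEdgeCluster ω s, s⟧) * ind D ω)
      = ∑ ω, ∑ W, (if openEdgeCluster ω s = W then weight w ω * (H W (ω \ B⟦W, s⟧) * ind D ω) else 0) :=
        Finset.sum_congr rfl fun ω _ =>
          (Fintype.sum_ite_eq (openEdgeCluster ω s) fun W => weight w ω * (H W (ω \ B⟦W, s⟧) * ind D ω)).symm
    _ = ∑ ω, ∑ W, (if openEdgeCluster ω s = W then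
          weight w ω * ((∑ η, weight w η * H W (η \ B⟦W, s⟧)) * ind D ω) else 0) := by
        rw [Finset.sum_comm, Finset.sum_congr rfl fun W _ => key W, Finset.sum_comm]
    _ = _ := Finset.sum_congr rfl fun ω _ =>
          Fintype.sum_ite_eq (openEdgeCluster ω s) fun W => weight w ω * ((∑ η, weight w η * H W (η \ B⟦W, s⟧)) * ind D ω)

/-- `∫_D 1{R} dμ = μ(D ∩ {R})` (for any decidability instance on `R`). [folklore] -/
theorem setIntegral_ite_eq (μ : Measure (BondConfig V)) (D : Set (BondConfig V)) (R : BondConfig V → Prop)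
    [DecidablePred R] : ∫ ω in D, (if R ω then (1 : ℝ) else 0) ∂μ = μ.real (D ∩ {ω | R ω}) := by
  have h : (fun ω => if R ω then (1 : ℝ) else 0) = {ω | R ω}.indicator 1 := by
    funext ω
    by_cases hR : R ω
    · rw [if_pos hR, Set.indicator_of_mem (show ω ∈ {ω | R ω} from hR), Pi.one_apply]
    · rw [if_neg hR, Set.indicator_of_notMem (show ω ∉ {ω | R ω} from hR)]
  rw [h, setIntegral_indicator MeasurableSet.of_discrete]
  simp only [Pi.one_apply, setIntegral_const, smul_eq_mul, mul_one]

end Sums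

section Assoc

variable [Fintype V] (w : Sym2 V → unitInterval) (s : V) (X : Set V)

/-- **Off-cluster association** (BHK's Theorem 1.5 with `C_t` replaced by the configuration off `C̄_s` and `{s ↮ t}`
by `{s ↮ X}`): for `s ∉ X`, `D = {s ↮ X} = {ω | ∀ x ∈ X, ¬ s ↔ x}`, `μ = prodBernoulli w`, and `F, G` increasing in the
first and decreasing in the second argument, `f(ω) = F(C_s ω, ω ∖ C̄_s ω)`, `g(ω) = G(C_s ω, ω ∖ C̄_s ω)` satisfy
`(∫_D f dμ)(∫_D g dμ) ≤ μ(D) ∫_D f g dμ`.  Proof = BHK's proof of Thm. 1.5: display (10), Harris off `W̄`, monotonicity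
in `W`, Theorem 1.3. [cite: VandenbergHaggstromKahn2005, Thm. 1.3 (p. 6), Thm. 1.5 (p. 7), proof pp. 7–8 — corollary] -/
theorem offClusterAssoc (hs : s ∉ X) (F G : Set (Sym2 V) → Set (Sym2 V) → ℝ)
    (hF1 : ∀ E, Monotone fun C => F C E) (hF2 : ∀ C, Antitone fun E => F C E)
    (hG1 : ∀ E, Monotone fun C => G C E) (hG2 : ∀ C, Antitone fun E => G C E) :
    (∫ ω in D⟦s, X⟧, F (openEdgeCluster ω s) (ω \ B⟦openEdgeCluster ω s, s⟧) ∂(prodBernoulli w)) *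
      (∫ ω in D⟦s, X⟧, G (openEdgeCluster ω s) (ω \ B⟦openEdgeCluster ω s, s⟧) ∂(prodBernoulli w)) ≤
    (prodBernoulli w).real D⟦s, X⟧ * ∫ ω in D⟦s, X⟧, F (openEdgeCluster ω s) (ω \ B⟦openEdgeCluster ω s, s⟧) *
      G (openEdgeCluster ω s) (ω \ B⟦openEdgeCluster ω s, s⟧) ∂(prodBernoulli w) := by
  set D : Set (BondConfig V) := D⟦s, X⟧ with hD
  have hDmem : ∀ ω, ω ∈ D ↔ ∀ x ∈ X, ¬ (openGraph ω).Reachable s x := fun ω => by rw [hD]; rfl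
  have hDm : MeasurableSet D := MeasurableSet.of_discrete
  set w' : Sym2 V → ℝ := fun e => (w e : ℝ) with hw'
  have hw0 : ∀ e, 0 ≤ w' e := fun e => (w e).2.1
  have hw1 : ∀ e, w' e ≤ 1 := fun e => (w e).2.2
  -- the integrals as finite sums
  have hint : ∀ h : Set (Sym2 V) → ℝ, ∫ ω in D, h ω ∂(prodBernoulli w) = ∑ ω, weight w' ω * (h ω * ind D ω) := by
    intro h
    rw [← integral_indicator hDm, integral_prodBernoulli_eq_sum]
    refine Finset.sum_congr rfl fun ω _ => ?_
    by_cases hω : ω ∈ D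
    · rw [Set.indicator_of_mem hω, ind_of_mem hω, mul_one]
    · rw [Set.indicator_of_notMem hω, ind_of_not_mem hω]; ring
  have hreal : (prodBernoulli w).real D = ∑ ω, weight w' ω * ind D ω := by
    rw [← integral_indicator_one hDm, integral_prodBernoulli_eq_sum]
    refine Finset.sum_congr rfl fun ω _ => ?_
    by_cases hω : ω ∈ D
    · rw [Set.indicator_of_mem hω, ind_of_mem hω, Pi.one_apply]
    · rw [Set.indicator_of_notMem hω, ind_of_not_mem hω, mul_zero]
  have hm : ∑ ω, weight w' ω = 1 := by
    have h1 := integral_prodBernoulli_eq_sum w fun _ => (1 : ℝ)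
    simp only [integral_const, probReal_univ, smul_eq_mul, mul_one] at h1
    exact h1.symm
  -- `E[f | C_s = W]`, `E[g | C_s = W]` are increasing in `W`: Theorem 1.3 given `{s ↮ X}`
  have h13 := BHK2006_clusterConditionalPositiveAssociation_holds V w s X
    (fun W => ∑ η, weight w' η * F W (η \ B⟦W, s⟧)) (fun W => ∑ η, weight w' η * G W (η \ B⟦W, s⟧))
    (condAvg_off_mono hw0 hw1 s hF1 hF2) (condAvg_off_mono hw0 hw1 s hG1 hG2) hs
  rw [← hD] at h13
  rw [hint, hint, hint (fun ω => (∑ η, weight w' η * F (openEdgeCluster ω s) (η \ B⟦openEdgeCluster ω s, s⟧)) *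
    ∑ η, weight w' η * G (openEdgeCluster ω s) (η \ B⟦openEdgeCluster ω s, s⟧)), hreal] at h13
  -- the three integrals of the goal, conditioned on `C_s` (display (10))
  rw [hint (fun ω => F (openEdgeCluster ω s) (ω \ B⟦openEdgeCluster ω s, s⟧)),
    hint (fun ω => G (openEdgeCluster ω s) (ω \ B⟦openEdgeCluster ω s, s⟧)),
    hint (fun ω => F (openEdgeCluster ω s) (ω \ B⟦openEdgeCluster ω s, s⟧) *
      G (openEdgeCluster ω s) (ω \ B⟦openEdgeCluster ω s, s⟧)), hreal]
  rw [sum_cond_cluster_off_ind w' hm s X F hDmem, sum_cond_cluster_off_ind w' hm s X G hDmem,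
    sum_cond_cluster_off_ind w' hm s X (fun C E => F C E * G C E) hDmem]
  -- Theorem 1.3, then Harris on each `{C_s = W}`
  exact h13.trans (mul_le_mul_of_nonneg_left (Finset.sum_le_sum fun ω _ => mul_le_mul_of_nonneg_left
    (mul_le_mul_of_nonneg_right (condAvg_off_mul_le hw0 hw1 hm _ hF2 hG2 _) (ind_nonneg _ _)) (weight_nonneg hw0 hw1 ω))
    (Finset.sum_nonneg fun ω _ => mul_nonneg (weight_nonneg hw0 hw1 ω) (ind_nonneg _ _)))

/-- **Off-cluster association, sign-flipped**: functions of `(C_s, ω ∖ C̄_s)` DEcreasing in `C_s` and INcreasing off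
`C̄_s` are positively associated given `D = {s ↮ X}` (`offClusterAssoc` for `(-f, -g)`).
[cite: VandenbergHaggstromKahn2005, Thm. 1.3 (p. 6), Thm. 1.5 (p. 7), proof pp. 7–8 — corollary] -/
theorem offClusterAssoc_anti_mono (hs : s ∉ X) (F G : Set (Sym2 V) → Set (Sym2 V) → ℝ)
    (hF1 : ∀ E, Antitone fun C => F C E) (hF2 : ∀ C, Monotone fun E => F C E)
    (hG1 : ∀ E, Antitone fun C => G C E) (hG2 : ∀ C, Monotone fun E => G C E) :
    (∫ ω in D⟦s, X⟧, F (openEdgeCluster ω s) (ω \ B⟦openEdgeCluster ω s, s⟧) ∂(prodBernoulli w)) *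
      (∫ ω in D⟦s, X⟧, G (openEdgeCluster ω s) (ω \ B⟦openEdgeCluster ω s, s⟧) ∂(prodBernoulli w)) ≤
    (prodBernoulli w).real D⟦s, X⟧ * ∫ ω in D⟦s, X⟧, F (openEdgeCluster ω s) (ω \ B⟦openEdgeCluster ω s, s⟧) *
      G (openEdgeCluster ω s) (ω \ B⟦openEdgeCluster ω s, s⟧) ∂(prodBernoulli w) := by
  have key := offClusterAssoc w s X hs (fun C E => -F C E) (fun C E => -G C E)
    (fun E _ _ h => neg_le_neg (hF1 E h)) (fun C _ _ h => neg_le_neg (hF2 C h))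
    (fun E _ _ h => neg_le_neg (hG1 E h)) (fun C _ _ h => neg_le_neg (hG2 C h))
  simp only [integral_neg, neg_mul_neg] at key
  exact key

/-- **Off-cluster association, mixed signs**: `f` decreasing in `C_s` and increasing off `C̄_s`, `g` increasing in `C_s`
and decreasing off `C̄_s` are negatively correlated given `D = {s ↮ X}`: `μ(D) ∫_D f g ≤ (∫_D f)(∫_D g)` (previous row
for `(f, -g)`). [cite: VandenbergHaggstromKahn2005, Thm. 1.3 (p. 6), Thm. 1.5 (p. 7), proof pp. 7–8 — corollary] -/
theorem offClusterAssoc_mixed (hs : s ∉ X) (F G : Set (Sym2 V) → Set (Sym2 V) → ℝ)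
    (hF1 : ∀ E, Antitone fun C => F C E) (hF2 : ∀ C, Monotone fun E => F C E)
    (hG1 : ∀ E, Monotone fun C => G C E) (hG2 : ∀ C, Antitone fun E => G C E) :
    (prodBernoulli w).real D⟦s, X⟧ * (∫ ω in D⟦s, X⟧, F (openEdgeCluster ω s) (ω \ B⟦openEdgeCluster ω s, s⟧) *
        G (openEdgeCluster ω s) (ω \ B⟦openEdgeCluster ω s, s⟧) ∂(prodBernoulli w)) ≤
    (∫ ω in D⟦s, X⟧, F (openEdgeCluster ω s) (ω \ B⟦openEdgeCluster ω s, s⟧) ∂(prodBernoulli w)) *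
      ∫ ω in D⟦s, X⟧, G (openEdgeCluster ω s) (ω \ B⟦openEdgeCluster ω s, s⟧) ∂(prodBernoulli w) := by
  have key := offClusterAssoc_anti_mono w s X hs F (fun C E => -G C E) hF1 hF2
    (fun E _ _ h => neg_le_neg (hG1 E h)) (fun C _ _ h => neg_le_neg (hG2 C h))
  simp only [mul_neg, integral_neg] at key
  linarith

/-- **(GP1) Two increasing functions `a = A(ω ∖ C̄_s)`, `b = B(ω ∖ C̄_s)` of the off-cluster configuration are positively
correlated given `D = {s ↮ X}`**: `(∫_D a)(∫_D b) ≤ μ(D) ∫_D a b`. [cite: VandenbergHaggstromKahn2005, Thm. 1.5 (p. 7) — corollary] -/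
theorem offCluster_posAssoc (hs : s ∉ X) (A B : Set (Sym2 V) → ℝ) (hA : Monotone A) (hB : Monotone B) :
    (∫ ω in D⟦s, X⟧, A (ω \ B⟦openEdgeCluster ω s, s⟧) ∂(prodBernoulli w)) *
      (∫ ω in D⟦s, X⟧, B (ω \ B⟦openEdgeCluster ω s, s⟧) ∂(prodBernoulli w)) ≤
    (prodBernoulli w).real D⟦s, X⟧ *
      ∫ ω in D⟦s, X⟧, A (ω \ B⟦openEdgeCluster ω s, s⟧) * B (ω \ B⟦openEdgeCluster ω s, s⟧) ∂(prodBernoulli w) :=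
  offClusterAssoc_anti_mono w s X hs (fun _ E => A E) (fun _ E => B E)
    (fun _ => antitone_const) (fun _ => hA) (fun _ => antitone_const) (fun _ => hB)

/-- **(GP3) An increasing function `a = A(ω ∖ C̄_s)` of the off-cluster configuration and an increasing function `g = G(C_s)`
are negatively correlated given `D = {s ↮ X}`**: `μ(D) ∫_D a g ≤ (∫_D a)(∫_D g)`. [cite: VandenbergHaggstromKahn2005, Thm. 1.5 (p. 7) — corollary] -/
theorem offCluster_cluster_negCorr (hs : s ∉ X) (A G : Set (Sym2 V) → ℝ) (hA : Monotone A) (hG : Monotone G) :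
    (prodBernoulli w).real D⟦s, X⟧ *
      (∫ ω in D⟦s, X⟧, A (ω \ B⟦openEdgeCluster ω s, s⟧) * G (openEdgeCluster ω s) ∂(prodBernoulli w)) ≤
    (∫ ω in D⟦s, X⟧, A (ω \ B⟦openEdgeCluster ω s, s⟧) ∂(prodBernoulli w)) *
      ∫ ω in D⟦s, X⟧, G (openEdgeCluster ω s) ∂(prodBernoulli w) :=
  offClusterAssoc_mixed w s X hs (fun _ E => A E) (fun C _ => G C)
    (fun _ => antitone_const) (fun _ => hA) (fun _ => hG) (fun _ => antitone_const)

/-- **Event form, two off-increasing events**: for predicates `P, Q` of `(C_s, ω ∖ C̄_s)` decreasing in `C_s` and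
increasing off `C̄_s`, `μ(D ∩ {P}) μ(D ∩ {Q}) ≤ μ(D) μ(D ∩ {P} ∩ {Q})`, `D = {s ↮ X}`.
[cite: VandenbergHaggstromKahn2005, Thm. 1.3 (p. 6), Thm. 1.5 (p. 7), proof pp. 7–8 — corollary] -/
theorem offCluster_event_posAssoc (hs : s ∉ X) (P Q : Set (Sym2 V) → Set (Sym2 V) → Prop)
    (hP1 : ∀ ⦃C C'⦄ (E), C ⊆ C' → P C' E → P C E) (hP2 : ∀ (C) ⦃E E'⦄, E ⊆ E' → P C E → P C E')
    (hQ1 : ∀ ⦃C C'⦄ (E), C ⊆ C' → Q C' E → Q C E) (hQ2 : ∀ (C) ⦃E E'⦄, E ⊆ E' → Q C E → Q C E') :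
    (prodBernoulli w).real (D⟦s, X⟧ ∩ {ω | P (openEdgeCluster ω s) (ω \ B⟦openEdgeCluster ω s, s⟧)}) *
      (prodBernoulli w).real (D⟦s, X⟧ ∩ {ω | Q (openEdgeCluster ω s) (ω \ B⟦openEdgeCluster ω s, s⟧)}) ≤
    (prodBernoulli w).real D⟦s, X⟧ * (prodBernoulli w).real (D⟦s, X⟧ ∩
      ({ω | P (openEdgeCluster ω s) (ω \ B⟦openEdgeCluster ω s, s⟧)} ∩
       {ω | Q (openEdgeCluster ω s) (ω \ B⟦openEdgeCluster ω s, s⟧)})) := by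
  have key := offClusterAssoc_anti_mono w s X hs
    (fun C E => if P C E then (1 : ℝ) else 0) (fun C E => if Q C E then (1 : ℝ) else 0)
    (fun E => antitone_ite fun _ _ h h' => hP1 E h h') (fun C => monotone_ite fun _ _ h h' => hP2 C h h')
    (fun E => antitone_ite fun _ _ h h' => hQ1 E h h') (fun C => monotone_ite fun _ _ h h' => hQ2 C h h')
  simp only [ite_one_mul_ite_one] at key
  rw [setIntegral_ite_eq, setIntegral_ite_eq, setIntegral_ite_eq] at key
  exact key

/-- **Event form, mixed**: `P` decreasing in `C_s` and increasing off `C̄_s`, `Q` increasing in `C_s` and decreasing off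
`C̄_s`: `μ(D) μ(D ∩ {P} ∩ {Q}) ≤ μ(D ∩ {P}) μ(D ∩ {Q})`, `D = {s ↮ X}`.
[cite: VandenbergHaggstromKahn2005, Thm. 1.3 (p. 6), Thm. 1.5 (p. 7), proof pp. 7–8 — corollary] -/
theorem offCluster_event_negCorr (hs : s ∉ X) (P Q : Set (Sym2 V) → Set (Sym2 V) → Prop)
    (hP1 : ∀ ⦃C C'⦄ (E), C ⊆ C' → P C' E → P C E) (hP2 : ∀ (C) ⦃E E'⦄, E ⊆ E' → P C E → P C E')
    (hQ1 : ∀ ⦃C C'⦄ (E), C ⊆ C' → Q C E → Q C' E) (hQ2 : ∀ (C) ⦃E E'⦄, E ⊆ E' → Q C E' → Q C E) :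
    (prodBernoulli w).real D⟦s, X⟧ * (prodBernoulli w).real (D⟦s, X⟧ ∩
      ({ω | P (openEdgeCluster ω s) (ω \ B⟦openEdgeCluster ω s, s⟧)} ∩
       {ω | Q (openEdgeCluster ω s) (ω \ B⟦openEdgeCluster ω s, s⟧)})) ≤
    (prodBernoulli w).real (D⟦s, X⟧ ∩ {ω | P (openEdgeCluster ω s) (ω \ B⟦openEdgeCluster ω s, s⟧)}) *
      (prodBernoulli w).real (D⟦s, X⟧ ∩ {ω | Q (openEdgeCluster ω s) (ω \ B⟦openEdgeCluster ω s, s⟧)}) := by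
  have key := offClusterAssoc_mixed w s X hs
    (fun C E => if P C E then (1 : ℝ) else 0) (fun C E => if Q C E then (1 : ℝ) else 0)
    (fun E => antitone_ite fun _ _ h h' => hP1 E h h') (fun C => monotone_ite fun _ _ h h' => hP2 C h h')
    (fun E => monotone_ite fun _ _ h h' => hQ1 E h h') (fun C => antitone_ite fun _ _ h h' => hQ2 C h h')
  simp only [ite_one_mul_ite_one] at key
  rw [setIntegral_ite_eq, setIntegral_ite_eq, setIntegral_ite_eq] at key
  exact key

/-- **(E1) Two `s`-free connection events are positively correlated given `D = {s ↮ X}`**: for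
`Eᵢ = {xᵢ ↔ yᵢ} ∩ {xᵢ ↮ s}`, `μ(D ∩ E₁) μ(D ∩ E₂) ≤ μ(D) μ(D ∩ E₁ ∩ E₂)` (no hypothesis on the vertices; `Eᵢ` is
increasing off `C̄_s` and decreasing in `C_s`, `openConn_inter_compl_eq`).
[cite: VandenbergHaggstromKahn2005, Thm. 1.3 (p. 6), Thm. 1.5 (p. 7), proof pp. 7–8 — corollary] -/
theorem sFreeConn_posAssoc (hs : s ∉ X) (x y x' y' : V) :
    (prodBernoulli w).real (D⟦s, X⟧ ∩ (openConn x y ∩ (openConn x s)ᶜ)) *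
      (prodBernoulli w).real (D⟦s, X⟧ ∩ (openConn x' y' ∩ (openConn x' s)ᶜ)) ≤
    (prodBernoulli w).real D⟦s, X⟧ *
      (prodBernoulli w).real (D⟦s, X⟧ ∩ ((openConn x y ∩ (openConn x s)ᶜ) ∩ (openConn x' y' ∩ (openConn x' s)ᶜ))) := by
  rw [openConn_inter_compl_eq s x y, openConn_inter_compl_eq s x' y']
  exact offCluster_event_posAssoc w s X hs
    (fun C E => (openGraph E).Reachable x y ∧ ¬ (x = s ∨ ∃ e ∈ C, x ∈ e))
    (fun C E => (openGraph E).Reachable x' y' ∧ ¬ (x' = s ∨ ∃ e ∈ C, x' ∈ e))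
    (fun _ _ _ hCC' h => ⟨h.1, fun h' => h.2 (h'.imp id fun ⟨e, he, hxe⟩ => ⟨e, hCC' he, hxe⟩)⟩)
    (fun _ _ _ hEE' h => ⟨h.1.mono (openGraph_le hEE'), h.2⟩)
    (fun _ _ _ hCC' h => ⟨h.1, fun h' => h.2 (h'.imp id fun ⟨e, he, hxe⟩ => ⟨e, hCC' he, hxe⟩)⟩)
    (fun _ _ _ hEE' h => ⟨h.1.mono (openGraph_le hEE'), h.2⟩)

/-- **(E3) An `s`-free connection event and a connection to `s` are negatively correlated given `D = {s ↮ X}`**: for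
`E₁ = {x ↔ y} ∩ {x ↮ s}`, `μ(D) μ(D ∩ E₁ ∩ {s ↔ z}) ≤ μ(D ∩ E₁) μ(D ∩ {s ↔ z})`.
[cite: VandenbergHaggstromKahn2005, Thm. 1.3 (p. 6), Thm. 1.5 (p. 7), proof pp. 7–8 — corollary] -/
theorem sFreeConn_openConn_negCorr (hs : s ∉ X) (x y z : V) :
    (prodBernoulli w).real D⟦s, X⟧ * (prodBernoulli w).real (D⟦s, X⟧ ∩ ((openConn x y ∩ (openConn x s)ᶜ) ∩ openConn s z)) ≤
    (prodBernoulli w).real (D⟦s, X⟧ ∩ (openConn x y ∩ (openConn x s)ᶜ)) * (prodBernoulli w).real (D⟦s, X⟧ ∩ openConn s z) := by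
  rw [openConn_inter_compl_eq s x y, openConn_eq_setOf s z]
  exact offCluster_event_negCorr w s X hs
    (fun C E => (openGraph E).Reachable x y ∧ ¬ (x = s ∨ ∃ e ∈ C, x ∈ e)) (fun C _ => z = s ∨ ∃ e ∈ C, z ∈ e)
    (fun _ _ _ hCC' h => ⟨h.1, fun h' => h.2 (h'.imp id fun ⟨e, he, hxe⟩ => ⟨e, hCC' he, hxe⟩)⟩)
    (fun _ _ _ hEE' h => ⟨h.1.mono (openGraph_le hEE'), h.2⟩)
    (fun _ _ _ hCC' h => h.imp id fun ⟨e, he, hze⟩ => ⟨e, hCC' he, hze⟩) (fun _ _ _ _ h => h)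

end Assoc

end OffCluster

end

end Summit.CriticalPhenomena.PercolationContinuityZ3.Cruxes.AdditiveGluing.TieLine
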